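import Summits.ValiantsHypothesis.ValiantsHypothesis.Theorems.GrenetZeonDualUnipotentThreeHalvesHeavyTopInvariantFlag
import Summits.ValiantsHypothesis.ValiantsHypothesis.Theorems.GrenetZeonDualUnipotentThreeHalvesHeavyTopGradedFlag

/-!
# `GrenetZeon.DualUnipotentThreeHalves` (stmt-ValiantsHypothesis-24318), R2 `HeavyTopLaw` — instrument kernel row
# «§8 enumerator soundness», LAYER 3a: THEOREM G with BLOCK-SPACE DIMENSIONS (the cost `p·n + Σ_t dim(𝒯|block t)`)

The core form ✓ `GrenetZeon.HeavyTopInvariantFlag.flagCheap_of_invariant_levels` (val-port-3 g2) bounds the codimension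
of the direction space `K = {v : every diagonal block of P·N_lin(v)·P⁻¹ vanishes}` by `Σ_t C(m_t, 2)` (Gerstenhaber on each
block space).  The composition-series bookkeeping of `INSTANCES.md` v2.2a §7–§8 needs the SAME theorem with the block
spaces' ACTUAL dimensions: `flagCheap_of_block_dims` — if the `t`-th block space of the conjugated tops (in any
re-indexing by `Fin s`) has dimension `≤ D t` and `p·n + Σ_{t<p} D t < n²`, then `FlagCheap n m N`.  The proof is
port-3's, with the Gerstenhaber step replaced by the hypothesis.  Two feeders for layer 3b:
`pencil_blockUpper_of_forall_mem` (a `P` making every member of `ℂ·N(0) + N_lin(ℂ^{n×n})` block upper triangular makes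
the pencil block upper triangular AS A POLYNOMIAL MATRIX — `MvPolynomial.funext`, as in ✓
`exists_strictUpper_conj_of_forall_mem`) and `isNilpotent_block_of_mem` (diagonal blocks of conjugated members of that
nilpotent space are nilpotent).

Honest framing: a certificate form for INSTANCE rows of the LAW R2 (desk RULING #299 (a); critic val-idea-crit-3 g4);
nothing here proves or refutes `HeavyTopLaw`, 24318, S3b or any `HeavyTopInst n m`; `VP ≠ VNP` is NOT proved; no summit
statement is proved here.  No definitions, no named facts.  [folklore]
-/

noncomputable section

-- single-conjunct layout: Sub = Summit, duplicated namespace component intended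
set_option linter.dupNamespace false

namespace Summit.ValiantsHypothesis.ValiantsHypothesis.Theorems.GrenetZeon.HeavyTopCompositionBound

open MvPolynomial Matrix
open scoped BigOperators
open Summit.ValiantsHypothesis.ValiantsHypothesis.Cruxes.TwoDimCoefficients.DimTwoCases (AffMat IsAffine)
open Summit.ValiantsHypothesis.ValiantsHypothesis.Theorems.GrenetZeon.RadicalSplit
open Summit.ValiantsHypothesis.ValiantsHypothesis.Theorems.GrenetZeon.HeavyTopInvariantFlag
  (flagCheap_of_block_levels toBlock_pow_of_blockUpper)
open Summit.ValiantsHypothesis.ValiantsHypothesis.Theorems.GrenetZeon.HeavyTopGradedFlag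
  (isNilpotent_of_mem_span_sup_range)

variable {m : ℕ}

/-! ## §1 Theorem G with block-space dimensions -/

set_option maxHeartbeats 800000 in
/-- **THEOREM G, dimension form.**  Let the affine pencil `N` be block upper triangular after the constant change of
basis `P` for the level function `lvl` with `p ≥ 1` levels.  If, for every level `t < p`, the space spanned by the
`t`-th diagonal blocks of the conjugated tops `P·N_lin(v)·P⁻¹` (re-indexed by some `Fin s`) has dimension `≤ D t`, and
`p·n + Σ_{t<p} D t < n²`, then `FlagCheap n m N` (constant block flag, budget `p − 1`, direction space
`K = {v : all diagonal blocks of P·N_lin(v)·P⁻¹ vanish}`, `codim K ≤ Σ_t D t`). [folklore; port-3 g2's Theorem G] -/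
theorem flagCheap_of_block_dims {n : ℕ} (N : AffMat n m) (hN : IsAffine N)
    (P : (Matrix (Fin m) (Fin m) ℂ)ˣ) (lvl : Fin m → ℕ) (p : ℕ) (hp : 1 ≤ p) (hlvl : ∀ i, lvl i < p)
    (hblock : ∀ i j : Fin m, lvl i < lvl j →
      ((P : Matrix (Fin m) (Fin m) ℂ).map C * N * (↑P⁻¹ : Matrix (Fin m) (Fin m) ℂ).map C :
        Matrix (Fin m) (Fin m) (MvPolynomial (Fin n × Fin n) ℂ)) i j = 0)
    (D : ℕ → ℕ)
    (hD : ∀ t : Fin p, ∃ (s : ℕ) (e : {i : Fin m // lvl i = (t : ℕ)} ≃ Fin s),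
      Module.finrank ℂ (Submodule.span ℂ (Set.range fun v : Fin n × Fin n → ℂ =>
        Matrix.reindex e e (((P : Matrix (Fin m) (Fin m) ℂ) * linPart N v * (↑P⁻¹ : Matrix (Fin m) (Fin m) ℂ)).toBlock
          (fun i => lvl i = (t : ℕ)) (fun i => lvl i = (t : ℕ))))) ≤ D t)
    (hbudget : p * n + ∑ t ∈ Finset.range p, D t < n ^ 2) :
    FlagCheap n m N := by
  classical
  -- the conjugated top map
  obtain ⟨T₀, hT₀⟩ := exists_topMap_linPart N hN
  let T : (Fin n × Fin n → ℂ) →ₗ[ℂ] Matrix (Fin m) (Fin m) ℂ :=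
    (LinearMap.mulRight ℂ (↑P⁻¹ : Matrix (Fin m) (Fin m) ℂ)) ∘ₗ
      (LinearMap.mulLeft ℂ (P : Matrix (Fin m) (Fin m) ℂ)) ∘ₗ T₀
  have hT : ∀ v, T v = (P : Matrix (Fin m) (Fin m) ℂ) * linPart N v * (↑P⁻¹ : Matrix (Fin m) (Fin m) ℂ) := by
    intro v
    simp only [T, LinearMap.coe_comp, Function.comp_apply, LinearMap.mulLeft_apply, LinearMap.mulRight_apply, hT₀]
  -- the block maps (in the re-indexings supplied by `hD`)
  choose sz e hsz using hD
  let blk : ∀ t : Fin p, Matrix (Fin m) (Fin m) ℂ →ₗ[ℂ] Matrix (Fin (sz t)) (Fin (sz t)) ℂ := fun t =>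
    (Matrix.reindexAlgEquiv ℂ ℂ (e t)).toLinearEquiv.toLinearMap ∘ₗ
      { toFun := fun A => A.toBlock (fun i => lvl i = (t : ℕ)) (fun i => lvl i = (t : ℕ))
        map_add' := fun A B => rfl
        map_smul' := fun c A => rfl }
  have hblk : ∀ (t : Fin p) (A : Matrix (Fin m) (Fin m) ℂ),
      blk t A = Matrix.reindexAlgEquiv ℂ ℂ (e t) (A.toBlock (fun i => lvl i = (t : ℕ)) (fun i => lvl i = (t : ℕ))) :=
    fun t A => rfl
  let Φ : (Fin n × Fin n → ℂ) →ₗ[ℂ] (∀ t : Fin p, Matrix (Fin (sz t)) (Fin (sz t)) ℂ) :=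
    LinearMap.pi fun t => blk t ∘ₗ T
  have hΦ : ∀ v t, Φ v t = blk t (T v) := fun v t => rfl
  -- the block spaces are the spans of the statement
  have hDt : ∀ t : Fin p, Module.finrank ℂ (LinearMap.range (blk t ∘ₗ T)) ≤ D t := by
    intro t
    have hrg : LinearMap.range (blk t ∘ₗ T) = Submodule.span ℂ (Set.range fun v : Fin n × Fin n → ℂ =>
        Matrix.reindex (e t) (e t) (((P : Matrix (Fin m) (Fin m) ℂ) * linPart N v * (↑P⁻¹ : Matrix (Fin m) (Fin m) ℂ)).toBlock
          (fun i => lvl i = (t : ℕ)) (fun i => lvl i = (t : ℕ)))) := by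
      rw [← Submodule.span_eq (LinearMap.range _), LinearMap.coe_range]
      congr 1
      ext M
      simp only [Set.mem_range, LinearMap.comp_apply, hblk, Matrix.coe_reindexAlgEquiv, hT]
    rw [hrg]
    exact hsz t
  -- the range of `Φ` embeds into the product of the block spaces
  have hrange : Module.finrank ℂ (LinearMap.range Φ) ≤ ∑ t : Fin p, D t := by
    let ι : LinearMap.range Φ →ₗ[ℂ] (∀ t : Fin p, LinearMap.range (blk t ∘ₗ T)) :=
      LinearMap.pi fun t =>
        { toFun := fun x => ⟨x.1 t, by
            obtain ⟨v, hv⟩ := LinearMap.mem_range.1 x.2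
            exact LinearMap.mem_range.2 ⟨v, by rw [← hv]; rfl⟩⟩
          map_add' := fun x y => rfl
          map_smul' := fun c x => rfl }
    have hι : Function.Injective ι := by
      intro x y hxy
      apply Subtype.ext
      funext t
      have := congr_arg (fun f => ((f t : LinearMap.range (blk t ∘ₗ T)) : Matrix (Fin (sz t)) (Fin (sz t)) ℂ))
        hxy
      exact this
    calc Module.finrank ℂ (LinearMap.range Φ)
        ≤ Module.finrank ℂ (∀ t : Fin p, LinearMap.range (blk t ∘ₗ T)) :=
          LinearMap.finrank_le_finrank_of_injective hι
      _ = ∑ t : Fin p, Module.finrank ℂ (LinearMap.range (blk t ∘ₗ T)) := Module.finrank_pi_fintype ℂ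
      _ ≤ ∑ t : Fin p, D t := Finset.sum_le_sum fun t _ => hDt t
  have hsum : ∑ t : Fin p, D t = ∑ t ∈ Finset.range p, D t := Fin.sum_univ_eq_sum_range (fun t => D t) p
  -- apply the core form with `K = ker Φ`
  refine flagCheap_of_block_levels N hN P lvl p hp hlvl hblock (LinearMap.ker Φ) (fun v hv i j he => ?_) ?_
  · have hv0 : Φ v = 0 := LinearMap.mem_ker.mp hv
    have hb : blk ⟨lvl i, hlvl i⟩ (T v) = 0 := by rw [← hΦ, hv0]; rfl
    rw [hblk, map_eq_zero_iff _ (Matrix.reindexAlgEquiv ℂ ℂ _).injective] at hb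
    have h0 := congr_fun (congr_fun hb ⟨i, rfl⟩) ⟨j, he.symm⟩
    rw [Matrix.toBlock_apply, Matrix.zero_apply] at h0
    rw [← hT]; exact h0
  · have h1 := LinearMap.finrank_range_add_finrank_ker Φ
    have h3 : Module.finrank ℂ (Fin n × Fin n → ℂ) = n * n := by
      rw [Module.finrank_fintype_fun_eq_card, Fintype.card_prod, Fintype.card_fin]
    have h4 : n ^ 2 = n * n := sq n
    rw [← hsum] at hbudget
    omega

/-! ## §2 Feeders: block triangularity of the pencil, nilpotency of the blocks -/

/-- **A `P` that makes every member of `ℂ·N(0) + N_lin(ℂ^{n×n})` block upper triangular makes the PENCIL block upper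
triangular as a polynomial matrix** (every value `N(x)` lies in the space; `MvPolynomial.funext`).
[folklore; cf. ✓ `exists_strictUpper_conj_of_forall_mem`] -/
theorem pencil_blockUpper_of_forall_mem {n : ℕ} (N : AffMat n m)
    (T : (Fin n × Fin n → ℂ) →ₗ[ℂ] Matrix (Fin m) (Fin m) ℂ) (hT : ∀ v, T v = linPart N v)
    (P : (Matrix (Fin m) (Fin m) ℂ)ˣ) (lvl : Fin m → ℕ)
    (hPW : ∀ A ∈ (ℂ ∙ N.map (MvPolynomial.eval 0)) ⊔ LinearMap.range T, ∀ i j : Fin m, lvl i < lvl j →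
      ((P : Matrix (Fin m) (Fin m) ℂ) * A * (↑P⁻¹ : Matrix (Fin m) (Fin m) ℂ)) i j = 0) :
    ∀ i j : Fin m, lvl i < lvl j →
      ((P : Matrix (Fin m) (Fin m) ℂ).map C * N * (↑P⁻¹ : Matrix (Fin m) (Fin m) ℂ).map C :
        Matrix (Fin m) (Fin m) (MvPolynomial (Fin n × Fin n) ℂ)) i j = 0 := by
  classical
  intro i j hij
  have hval : ∀ x : Fin n × Fin n → ℂ,
      ((P : Matrix (Fin m) (Fin m) ℂ) * N.map (MvPolynomial.eval x) * (↑P⁻¹ : Matrix (Fin m) (Fin m) ℂ)) i j = 0 := by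
    intro x
    have hmem : N.map (MvPolynomial.eval x) ∈ (ℂ ∙ N.map (MvPolynomial.eval 0)) ⊔ LinearMap.range T := by
      have h1 : N.map (MvPolynomial.eval x) = N.map (MvPolynomial.eval 0) + T x := by
        rw [hT]; unfold linPart; abel
      rw [h1]
      exact Submodule.add_mem_sup (Submodule.mem_span_singleton_self _) (LinearMap.mem_range_self T x)
    exact hPW _ hmem i j hij
  apply MvPolynomial.funext
  intro x
  rw [map_zero]
  have hev : MvPolynomial.eval x ((((P : Matrix (Fin m) (Fin m) ℂ)).map C * N * (↑P⁻¹ : Matrix (Fin m) (Fin m) ℂ).map C :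
      Matrix (Fin m) (Fin m) (MvPolynomial (Fin n × Fin n) ℂ)) i j) =
      (((((P : Matrix (Fin m) (Fin m) ℂ)).map C * N * (↑P⁻¹ : Matrix (Fin m) (Fin m) ℂ).map C).map
        (MvPolynomial.eval x)) i j) := rfl
  rw [hev, Matrix.map_mul, Matrix.map_mul, Matrix.map_map, Matrix.map_map]
  have hC : ((MvPolynomial.eval x : MvPolynomial (Fin n × Fin n) ℂ → ℂ) ∘ (C : ℂ → MvPolynomial (Fin n × Fin n) ℂ)) = id :=
    funext fun a => by simp
  rw [hC, Matrix.map_id, Matrix.map_id]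
  exact hval x

/-- **Diagonal blocks of conjugated members of the nilpotent space are nilpotent** (in any re-indexing).  For
`A ∈ ℂ·N(0) + N_lin(ℂ^{n×n})` (`N` affine nilpotent), if `P·A'·P⁻¹` is block upper triangular for every member `A'`,
then every diagonal block of `P·A·P⁻¹` is nilpotent. [folklore] -/
theorem isNilpotent_block_of_mem {n : ℕ} (N : AffMat n m) (hN : IsAffine N) (hnil : N ^ m = 0)
    (T : (Fin n × Fin n → ℂ) →ₗ[ℂ] Matrix (Fin m) (Fin m) ℂ) (hT : ∀ v, T v = linPart N v)
    (P : (Matrix (Fin m) (Fin m) ℂ)ˣ) (lvl : Fin m → ℕ)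
    (A : Matrix (Fin m) (Fin m) ℂ) (hA : A ∈ (ℂ ∙ N.map (MvPolynomial.eval 0)) ⊔ LinearMap.range T)
    (hAP : ∀ i j : Fin m, lvl i < lvl j → ((P : Matrix (Fin m) (Fin m) ℂ) * A * (↑P⁻¹ : Matrix (Fin m) (Fin m) ℂ)) i j = 0)
    (t : ℕ) {s : ℕ} (e : {i : Fin m // lvl i = t} ≃ Fin s) :
    IsNilpotent (Matrix.reindex e e
      ((((P : Matrix (Fin m) (Fin m) ℂ) * A * (↑P⁻¹ : Matrix (Fin m) (Fin m) ℂ)).toBlock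
        (fun i => lvl i = t) (fun i => lvl i = t)))) := by
  obtain ⟨k, hk⟩ := isNilpotent_of_mem_span_sup_range N hN hnil T hT A hA
  refine ⟨k, ?_⟩
  have hconj : (((P : Matrix (Fin m) (Fin m) ℂ) * A * (↑P⁻¹ : Matrix (Fin m) (Fin m) ℂ))) ^ k = 0 := by
    rw [Units.conj_pow, hk, Matrix.mul_zero, Matrix.zero_mul]
  rw [← Matrix.coe_reindexAlgEquiv ℂ ℂ e, ← map_pow, ← toBlock_pow_of_blockUpper lvl _ hAP t k, hconj]
  have h0 : (0 : Matrix (Fin m) (Fin m) ℂ).toBlock (fun i => lvl i = t) (fun i => lvl i = t) = 0 := rfl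
  rw [h0, map_zero]

/-- **Block-space dimension transfer.**  The `t`-th block space of the conjugated TOPS sits inside the `t`-th block space
of the conjugated nilpotent space `W = ℂ·N(0) + N_lin(ℂ^{n×n})`, a NILPOTENT linear subspace of `M_s(ℂ)`; if that space
acts IRREDUCIBLY (layer 2's blocks), any bound `β` valid for irreducible nilpotent subspaces of `M_s(ℂ)` bounds the
dimension that enters the cost of `flagCheap_of_block_dims`.  (With `β = C(s,2)` and Gerstenhaber ✓ `finrank_le_choose_two`
the irreducibility hypothesis of `hβ` is simply ignored.) [folklore] -/
theorem finrank_blockSpan_le {n : ℕ} (N : AffMat n m) (hN : IsAffine N) (hnil : N ^ m = 0)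
    (T : (Fin n × Fin n → ℂ) →ₗ[ℂ] Matrix (Fin m) (Fin m) ℂ) (hT : ∀ v, T v = linPart N v)
    (P : (Matrix (Fin m) (Fin m) ℂ)ˣ) (lvl : Fin m → ℕ)
    (hPW : ∀ A ∈ (ℂ ∙ N.map (MvPolynomial.eval 0)) ⊔ LinearMap.range T, ∀ i j : Fin m, lvl i < lvl j →
      ((P : Matrix (Fin m) (Fin m) ℂ) * A * (↑P⁻¹ : Matrix (Fin m) (Fin m) ℂ)) i j = 0)
    (t : ℕ) {s : ℕ} (e : {i : Fin m // lvl i = t} ≃ Fin s) (β : ℕ)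
    (hβ : ∀ V : Submodule ℂ (Matrix (Fin s) (Fin s) ℂ), (∀ B ∈ V, IsNilpotent B) →
      (∀ U : Submodule ℂ (Fin s → ℂ), (∀ B ∈ V, ∀ x ∈ U, B *ᵥ x ∈ U) → U = ⊥ ∨ U = ⊤) →
      Module.finrank ℂ V ≤ β)
    (hirr : ∀ U : Submodule ℂ (Fin s → ℂ),
      (∀ A ∈ (ℂ ∙ N.map (MvPolynomial.eval 0)) ⊔ LinearMap.range T, ∀ x ∈ U,
        Matrix.reindex e e ((((P : Matrix (Fin m) (Fin m) ℂ) * A * (↑P⁻¹ : Matrix (Fin m) (Fin m) ℂ)).toBlock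
          (fun i => lvl i = t) (fun i => lvl i = t))) *ᵥ x ∈ U) → U = ⊥ ∨ U = ⊤) :
    Module.finrank ℂ (Submodule.span ℂ (Set.range fun v : Fin n × Fin n → ℂ =>
        Matrix.reindex e e (((P : Matrix (Fin m) (Fin m) ℂ) * linPart N v * (↑P⁻¹ : Matrix (Fin m) (Fin m) ℂ)).toBlock
          (fun i => lvl i = t) (fun i => lvl i = t)))) ≤ β := by
  classical
  let blkW : Matrix (Fin m) (Fin m) ℂ →ₗ[ℂ] Matrix (Fin s) (Fin s) ℂ :=
    { toFun := fun A => Matrix.reindex e e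
        ((((P : Matrix (Fin m) (Fin m) ℂ) * A * (↑P⁻¹ : Matrix (Fin m) (Fin m) ℂ)).toBlock
          (fun i => lvl i = t) (fun i => lvl i = t)))
      map_add' := fun A B => by
        ext a c
        simp only [Matrix.reindex_apply, Matrix.submatrix_apply, Matrix.toBlock_apply, Matrix.add_apply,
          Matrix.mul_add, Matrix.add_mul]
      map_smul' := fun c A => by
        ext a a'
        simp only [Matrix.reindex_apply, Matrix.submatrix_apply, Matrix.toBlock_apply, Matrix.smul_apply,
          Matrix.mul_smul, Matrix.smul_mul, RingHom.id_apply] }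
  have hVnil : ∀ B ∈ ((ℂ ∙ N.map (MvPolynomial.eval 0)) ⊔ LinearMap.range T).map blkW, IsNilpotent B := by
    intro B hB
    obtain ⟨A, hA, rfl⟩ := Submodule.mem_map.1 hB
    exact isNilpotent_block_of_mem N hN hnil T hT P lvl A hA (hPW A hA) t e
  have hVirr : ∀ U : Submodule ℂ (Fin s → ℂ),
      (∀ B ∈ ((ℂ ∙ N.map (MvPolynomial.eval 0)) ⊔ LinearMap.range T).map blkW, ∀ x ∈ U, B *ᵥ x ∈ U) →
      U = ⊥ ∨ U = ⊤ :=
    fun U hU => hirr U fun A hA x hx => hU (blkW A) (Submodule.mem_map_of_mem hA) x hx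
  refine (Submodule.finrank_mono ?_).trans (hβ _ hVnil hVirr)
  rw [Submodule.span_le]
  rintro _ ⟨v, rfl⟩
  refine ⟨linPart N v, ?_, rfl⟩
  rw [SetLike.mem_coe, ← hT]
  exact Submodule.mem_sup_right (LinearMap.mem_range_self T v)

end Summit.ValiantsHypothesis.ValiantsHypothesis.Theorems.GrenetZeon.HeavyTopCompositionBound

end
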